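import Summits.Ventures.PercRepro2.CaseOneHB1Avoid

/-!
# The sibling cell inequalities of `hB1` (blind cell PercRepro2, p1 g36; proofs/P1-HB1.md §3′)

`hB1` (`CaseOne.HB1_holds`) is `c₁ · c₁₀ ≤ c₉ · c₄` for the cells of `CaseOneStarCells` with the
marks `(o, a₁, a₂, b)`. The cell index is symmetric under the two relabellings of the marks:
swapping `o ↔ b` exchanges cells `1 ↔ 3` and fixes `4, 9, 10`; swapping the roots `a₁ ↔ a₂`
exchanges `1 ↔ 2`, `3 ↔ 6`, `4 ↔ 8` and fixes `9, 10`. Hence (P1-G35 §6.2's census-clean siblings)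
`c₃ · c₁₀ ≤ c₉ · c₄` (`HB1_ob`), `c₂ · c₁₀ ≤ c₉ · c₈` (`HB1_roots`), `c₆ · c₁₀ ≤ c₉ · c₈`
(`HB1_both`), and — the two-mark avoidance inequality with the SOURCE `a₁` and the marks `b, o` —
`c₁ · c₃ ≤ c₉ · c₄` (`HB1_root_source`). Standard axioms. -/

namespace Summit.Ventures.PercRepro2

namespace CaseOne

section Cells

variable {V : Type*} {E : Type*}

/-- Status `2` means `v ∈ C(a₂)` (and `v ∉ C(a₁)`). -/
lemma of_status_eq_two {ends : E → Sym2 V} {ω : Config E} {a₁ a₂ v : V}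
    (h : status ends ω a₁ a₂ v = 2) : ¬ Conn ends ω a₁ v ∧ Conn ends ω a₂ v := by
  unfold status at h
  by_cases h1 : Conn ends ω a₁ v
  · rw [if_pos h1] at h; norm_num at h
  · rw [if_neg h1] at h
    by_cases h2 : Conn ends ω a₂ v
    · exact ⟨h1, h2⟩
    · rw [if_neg h2] at h; norm_num at h

/-- A cell index in `1..8` off the «both outside» branch: `cellIdx = 3·s(o) + s(b)`. -/
lemma cellIdx_eq_of_status {ends : E → Sym2 V} {ω : Config E} {o a₁ a₂ b : V}
    (hQ : ¬ Conn ends ω a₁ a₂) (h : ¬ (status ends ω a₁ a₂ o = 0 ∧ status ends ω a₁ a₂ b = 0)) :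
    cellIdx ends ω o a₁ a₂ b = 3 * status ends ω a₁ a₂ o + status ends ω a₁ a₂ b := by
  unfold cellIdx
  rw [if_neg hQ, if_neg h]

/-- The cell index off `Q₀` and off the «both outside» branch, unpacked into the statuses. -/
lemma status_of_cellIdx {ends : E → Sym2 V} {ω : Config E} {o a₁ a₂ b : V} {k : ℕ}
    (hk : 1 ≤ k) (hk' : k ≤ 8) (h : cellIdx ends ω o a₁ a₂ b = k) :
    ¬ Conn ends ω a₁ a₂ ∧ 3 * status ends ω a₁ a₂ o + status ends ω a₁ a₂ b = k := by
  unfold cellIdx at h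
  by_cases hQ : Conn ends ω a₁ a₂
  · rw [if_pos hQ] at h; omega
  rw [if_neg hQ] at h
  by_cases hz : status ends ω a₁ a₂ o = 0 ∧ status ends ω a₁ a₂ b = 0
  · rw [if_pos hz] at h
    by_cases hob : Conn ends ω o b
    · rw [if_pos hob] at h; omega
    · rw [if_neg hob] at h; omega
  rw [if_neg hz] at h
  exact ⟨hQ, h⟩

/-- Cell `2` unpacked: `a₁ ↮ a₂`, `o ∉ C(a₁) ∪ C(a₂)`, `b ∈ C(a₂)`. -/
lemma of_cellIdx_eq_two {ends : E → Sym2 V} {ω : Config E} {o a₁ a₂ b : V}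
    (h : cellIdx ends ω o a₁ a₂ b = 2) :
    ¬ Conn ends ω a₁ a₂ ∧ (¬ Conn ends ω a₁ o ∧ ¬ Conn ends ω a₂ o) ∧ Conn ends ω a₂ b := by
  obtain ⟨hQ, h'⟩ := status_of_cellIdx (by norm_num) (by norm_num) h
  rcases status_cases ends ω a₁ a₂ o with ho | ho | ho <;>
    rcases status_cases ends ω a₁ a₂ b with hb | hb | hb <;> rw [ho, hb] at h' <;> norm_num at h'
  exact ⟨hQ, status_eq_zero_iff.1 ho, (of_status_eq_two hb).2⟩

/-- Cell `2` assembled. -/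
lemma cellIdx_eq_two {ends : E → Sym2 V} {ω : Config E} {o a₁ a₂ b : V}
    (hQ : ¬ Conn ends ω a₁ a₂) (ho1 : ¬ Conn ends ω a₁ o) (ho2 : ¬ Conn ends ω a₂ o)
    (hb : Conn ends ω a₂ b) : cellIdx ends ω o a₁ a₂ b = 2 := by
  have hb1 : ¬ Conn ends ω a₁ b := fun h => hQ (conn_trans h (conn_symm hb))
  have hso : status ends ω a₁ a₂ o = 0 := status_eq_zero_iff.2 ⟨ho1, ho2⟩
  have hsb : status ends ω a₁ a₂ b = 2 := by unfold status; rw [if_neg hb1, if_pos hb]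
  rw [cellIdx_eq_of_status hQ (fun h => by rw [hsb] at h; omega), hso, hsb]

/-- Cell `3` unpacked: `a₁ ↮ a₂`, `o ∈ C(a₁)`, `b ∉ C(a₁) ∪ C(a₂)`. -/
lemma of_cellIdx_eq_three {ends : E → Sym2 V} {ω : Config E} {o a₁ a₂ b : V}
    (h : cellIdx ends ω o a₁ a₂ b = 3) :
    ¬ Conn ends ω a₁ a₂ ∧ Conn ends ω a₁ o ∧ (¬ Conn ends ω a₁ b ∧ ¬ Conn ends ω a₂ b) := by
  obtain ⟨hQ, h'⟩ := status_of_cellIdx (by norm_num) (by norm_num) h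
  rcases status_cases ends ω a₁ a₂ o with ho | ho | ho <;>
    rcases status_cases ends ω a₁ a₂ b with hb | hb | hb <;> rw [ho, hb] at h' <;> norm_num at h'
  exact ⟨hQ, conn_a1_of_status_eq_one ho, status_eq_zero_iff.1 hb⟩

/-- Cell `3` assembled. -/
lemma cellIdx_eq_three {ends : E → Sym2 V} {ω : Config E} {o a₁ a₂ b : V}
    (hQ : ¬ Conn ends ω a₁ a₂) (ho : Conn ends ω a₁ o) (hb1 : ¬ Conn ends ω a₁ b)
    (hb2 : ¬ Conn ends ω a₂ b) : cellIdx ends ω o a₁ a₂ b = 3 := by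
  have hso : status ends ω a₁ a₂ o = 1 := by unfold status; rw [if_pos ho]
  have hsb : status ends ω a₁ a₂ b = 0 := status_eq_zero_iff.2 ⟨hb1, hb2⟩
  rw [cellIdx_eq_of_status hQ (fun h => by rw [hso] at h; omega), hso, hsb]

/-- Cell `6` unpacked: `a₁ ↮ a₂`, `o ∈ C(a₂)`, `b ∉ C(a₁) ∪ C(a₂)`. -/
lemma of_cellIdx_eq_six {ends : E → Sym2 V} {ω : Config E} {o a₁ a₂ b : V}
    (h : cellIdx ends ω o a₁ a₂ b = 6) :
    ¬ Conn ends ω a₁ a₂ ∧ Conn ends ω a₂ o ∧ (¬ Conn ends ω a₁ b ∧ ¬ Conn ends ω a₂ b) := by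
  obtain ⟨hQ, h'⟩ := status_of_cellIdx (by norm_num) (by norm_num) h
  rcases status_cases ends ω a₁ a₂ o with ho | ho | ho <;>
    rcases status_cases ends ω a₁ a₂ b with hb | hb | hb <;> rw [ho, hb] at h' <;> norm_num at h'
  exact ⟨hQ, (of_status_eq_two ho).2, status_eq_zero_iff.1 hb⟩

/-- Cell `6` assembled. -/
lemma cellIdx_eq_six {ends : E → Sym2 V} {ω : Config E} {o a₁ a₂ b : V}
    (hQ : ¬ Conn ends ω a₁ a₂) (ho : Conn ends ω a₂ o) (hb1 : ¬ Conn ends ω a₁ b)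
    (hb2 : ¬ Conn ends ω a₂ b) : cellIdx ends ω o a₁ a₂ b = 6 := by
  have ho1 : ¬ Conn ends ω a₁ o := fun h => hQ (conn_trans h (conn_symm ho))
  have hso : status ends ω a₁ a₂ o = 2 := by unfold status; rw [if_neg ho1, if_pos ho]
  have hsb : status ends ω a₁ a₂ b = 0 := status_eq_zero_iff.2 ⟨hb1, hb2⟩
  rw [cellIdx_eq_of_status hQ (fun h => by rw [hso] at h; omega), hso, hsb]

/-- Cell `8` unpacked: `a₁ ↮ a₂`, `o, b ∈ C(a₂)`. -/
lemma of_cellIdx_eq_eight {ends : E → Sym2 V} {ω : Config E} {o a₁ a₂ b : V}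
    (h : cellIdx ends ω o a₁ a₂ b = 8) :
    ¬ Conn ends ω a₁ a₂ ∧ Conn ends ω a₂ o ∧ Conn ends ω a₂ b := by
  obtain ⟨hQ, h'⟩ := status_of_cellIdx (by norm_num) (by norm_num) h
  rcases status_cases ends ω a₁ a₂ o with ho | ho | ho <;>
    rcases status_cases ends ω a₁ a₂ b with hb | hb | hb <;> rw [ho, hb] at h' <;> norm_num at h'
  exact ⟨hQ, (of_status_eq_two ho).2, (of_status_eq_two hb).2⟩

/-- Cell `8` assembled. -/
lemma cellIdx_eq_eight {ends : E → Sym2 V} {ω : Config E} {o a₁ a₂ b : V}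
    (hQ : ¬ Conn ends ω a₁ a₂) (ho : Conn ends ω a₂ o) (hb : Conn ends ω a₂ b) :
    cellIdx ends ω o a₁ a₂ b = 8 := by
  have ho1 : ¬ Conn ends ω a₁ o := fun h => hQ (conn_trans h (conn_symm ho))
  have hb1 : ¬ Conn ends ω a₁ b := fun h => hQ (conn_trans h (conn_symm hb))
  have hso : status ends ω a₁ a₂ o = 2 := by unfold status; rw [if_neg ho1, if_pos ho]
  have hsb : status ends ω a₁ a₂ b = 2 := by unfold status; rw [if_neg hb1, if_pos hb]
  rw [cellIdx_eq_of_status hQ (fun h => by rw [hso] at h; omega), hso, hsb]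

end Cells

/-! ## The relabellings of the cells -/

section Swap

variable {V : Type*} {E : Type*} [Fintype E] [DecidableEq E] {R : Type*} [CommRing R]

/-- `o ↔ b`: cell `1` of `(b, a₁, a₂, o)` is cell `3` of `(o, a₁, a₂, b)`. -/
lemma cellMass_swap_ob_one (p : E → R) (ends : E → Sym2 V) (o a₁ a₂ b : V) :
    cellMass p ends b a₁ a₂ o 1 = cellMass p ends o a₁ a₂ b 3 := by
  unfold cellMass; congr 1; ext ω; simp only [Set.mem_setOf_eq]
  constructor
  · intro h
    obtain ⟨hQ, ho, hb1, hb2⟩ := of_cellIdx_eq_one h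
    exact cellIdx_eq_three hQ ho hb1 hb2
  · intro h
    obtain ⟨hQ, ho, hb1, hb2⟩ := of_cellIdx_eq_three h
    exact cellIdx_eq_one hQ ho hb1 hb2

/-- `o ↔ b`: cell `4` is symmetric. -/
lemma cellMass_swap_ob_four (p : E → R) (ends : E → Sym2 V) (o a₁ a₂ b : V) :
    cellMass p ends b a₁ a₂ o 4 = cellMass p ends o a₁ a₂ b 4 := by
  unfold cellMass; congr 1; ext ω; simp only [Set.mem_setOf_eq]
  constructor
  · intro h
    obtain ⟨hQ, hb, ho⟩ := of_cellIdx_eq_four h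
    exact cellIdx_eq_four hQ ho hb
  · intro h
    obtain ⟨hQ, ho, hb⟩ := of_cellIdx_eq_four h
    exact cellIdx_eq_four hQ hb ho

/-- `o ↔ b`: cell `9` is symmetric. -/
lemma cellMass_swap_ob_nine (p : E → R) (ends : E → Sym2 V) (o a₁ a₂ b : V) :
    cellMass p ends b a₁ a₂ o 9 = cellMass p ends o a₁ a₂ b 9 := by
  unfold cellMass; congr 1; ext ω; simp only [Set.mem_setOf_eq]
  constructor
  · intro h
    obtain ⟨hQ, ⟨hb1, hb2⟩, ⟨ho1, ho2⟩, hbo⟩ := of_cellIdx_eq_nine h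
    exact cellIdx_eq_nine hQ ho1 ho2 hb1 hb2 (fun h' => hbo (conn_symm h'))
  · intro h
    obtain ⟨hQ, ⟨ho1, ho2⟩, ⟨hb1, hb2⟩, hob⟩ := of_cellIdx_eq_nine h
    exact cellIdx_eq_nine hQ hb1 hb2 ho1 ho2 (fun h' => hob (conn_symm h'))

/-- `o ↔ b`: cell `10` is symmetric. -/
lemma cellMass_swap_ob_ten (p : E → R) (ends : E → Sym2 V) (o a₁ a₂ b : V) :
    cellMass p ends b a₁ a₂ o 10 = cellMass p ends o a₁ a₂ b 10 := by
  unfold cellMass; congr 1; ext ω; simp only [Set.mem_setOf_eq]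
  constructor
  · intro h
    obtain ⟨hQ, ⟨hb1, hb2⟩, ⟨ho1, ho2⟩, hbo⟩ := of_cellIdx_eq_ten h
    exact cellIdx_eq_ten hQ ho1 ho2 hb1 hb2 (conn_symm hbo)
  · intro h
    obtain ⟨hQ, ⟨ho1, ho2⟩, ⟨hb1, hb2⟩, hob⟩ := of_cellIdx_eq_ten h
    exact cellIdx_eq_ten hQ hb1 hb2 ho1 ho2 (conn_symm hob)

/-- `a₁ ↔ a₂`: cell `1` of `(o, a₂, a₁, b)` is cell `2` of `(o, a₁, a₂, b)`. -/
lemma cellMass_swap_roots_one (p : E → R) (ends : E → Sym2 V) (o a₁ a₂ b : V) :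
    cellMass p ends o a₂ a₁ b 1 = cellMass p ends o a₁ a₂ b 2 := by
  unfold cellMass; congr 1; ext ω; simp only [Set.mem_setOf_eq]
  constructor
  · intro h
    obtain ⟨hQ, hb, ho2, ho1⟩ := of_cellIdx_eq_one h
    exact cellIdx_eq_two (fun h' => hQ (conn_symm h')) ho1 ho2 hb
  · intro h
    obtain ⟨hQ, ⟨ho1, ho2⟩, hb⟩ := of_cellIdx_eq_two h
    exact cellIdx_eq_one (fun h' => hQ (conn_symm h')) hb ho2 ho1

/-- `a₁ ↔ a₂`: cell `3` of `(o, a₂, a₁, b)` is cell `6` of `(o, a₁, a₂, b)`. -/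
lemma cellMass_swap_roots_three (p : E → R) (ends : E → Sym2 V) (o a₁ a₂ b : V) :
    cellMass p ends o a₂ a₁ b 3 = cellMass p ends o a₁ a₂ b 6 := by
  unfold cellMass; congr 1; ext ω; simp only [Set.mem_setOf_eq]
  constructor
  · intro h
    obtain ⟨hQ, ho, hb2, hb1⟩ := of_cellIdx_eq_three h
    exact cellIdx_eq_six (fun h' => hQ (conn_symm h')) ho hb1 hb2
  · intro h
    obtain ⟨hQ, ho, hb1, hb2⟩ := of_cellIdx_eq_six h
    exact cellIdx_eq_three (fun h' => hQ (conn_symm h')) ho hb2 hb1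

/-- `a₁ ↔ a₂`: cell `4` of `(o, a₂, a₁, b)` is cell `8` of `(o, a₁, a₂, b)`. -/
lemma cellMass_swap_roots_four (p : E → R) (ends : E → Sym2 V) (o a₁ a₂ b : V) :
    cellMass p ends o a₂ a₁ b 4 = cellMass p ends o a₁ a₂ b 8 := by
  unfold cellMass; congr 1; ext ω; simp only [Set.mem_setOf_eq]
  constructor
  · intro h
    obtain ⟨hQ, ho, hb⟩ := of_cellIdx_eq_four h
    exact cellIdx_eq_eight (fun h' => hQ (conn_symm h')) ho hb
  · intro h
    obtain ⟨hQ, ho, hb⟩ := of_cellIdx_eq_eight h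
    exact cellIdx_eq_four (fun h' => hQ (conn_symm h')) ho hb

/-- `a₁ ↔ a₂`: cell `9` is symmetric. -/
lemma cellMass_swap_roots_nine (p : E → R) (ends : E → Sym2 V) (o a₁ a₂ b : V) :
    cellMass p ends o a₂ a₁ b 9 = cellMass p ends o a₁ a₂ b 9 := by
  unfold cellMass; congr 1; ext ω; simp only [Set.mem_setOf_eq]
  constructor
  · intro h
    obtain ⟨hQ, ⟨ho2, ho1⟩, ⟨hb2, hb1⟩, hob⟩ := of_cellIdx_eq_nine h
    exact cellIdx_eq_nine (fun h' => hQ (conn_symm h')) ho1 ho2 hb1 hb2 hob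
  · intro h
    obtain ⟨hQ, ⟨ho1, ho2⟩, ⟨hb1, hb2⟩, hob⟩ := of_cellIdx_eq_nine h
    exact cellIdx_eq_nine (fun h' => hQ (conn_symm h')) ho2 ho1 hb2 hb1 hob

/-- `a₁ ↔ a₂`: cell `10` is symmetric. -/
lemma cellMass_swap_roots_ten (p : E → R) (ends : E → Sym2 V) (o a₁ a₂ b : V) :
    cellMass p ends o a₂ a₁ b 10 = cellMass p ends o a₁ a₂ b 10 := by
  unfold cellMass; congr 1; ext ω; simp only [Set.mem_setOf_eq]
  constructor
  · intro h
    obtain ⟨hQ, ⟨ho2, ho1⟩, ⟨hb2, hb1⟩, hob⟩ := of_cellIdx_eq_ten h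
    exact cellIdx_eq_ten (fun h' => hQ (conn_symm h')) ho1 ho2 hb1 hb2 hob
  · intro h
    obtain ⟨hQ, ⟨ho1, ho2⟩, ⟨hb1, hb2⟩, hob⟩ := of_cellIdx_eq_ten h
    exact cellIdx_eq_ten (fun h' => hQ (conn_symm h')) ho2 ho1 hb2 hb1 hob

end Swap

/-! ## The siblings -/

section Siblings

variable {V : Type*} {E : Type*} [Fintype E] [DecidableEq E] [Fintype V] [DecidableEq V]
  {R : Type*} [CommRing R] [LinearOrder R] [IsStrictOrderedRing R]

/-- **Sibling `c₃ · c₁₀ ≤ c₉ · c₄`** (`hB1` with `o ↔ b`). -/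
theorem HB1_ob (p : E → R) (hp : IsProbVec p) (ends : E → Sym2 V) (o a₁ a₂ b : V) :
    cellMass p ends o a₁ a₂ b 3 * cellMass p ends o a₁ a₂ b 10 ≤
      cellMass p ends o a₁ a₂ b 9 * cellMass p ends o a₁ a₂ b 4 := by
  have h := HB1_holds p hp ends b a₁ a₂ o
  unfold HB1 at h
  rwa [cellMass_swap_ob_one, cellMass_swap_ob_four, cellMass_swap_ob_nine,
    cellMass_swap_ob_ten] at h

/-- **Sibling `c₂ · c₁₀ ≤ c₉ · c₈`** (`hB1` with `a₁ ↔ a₂`). -/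
theorem HB1_roots (p : E → R) (hp : IsProbVec p) (ends : E → Sym2 V) (o a₁ a₂ b : V) :
    cellMass p ends o a₁ a₂ b 2 * cellMass p ends o a₁ a₂ b 10 ≤
      cellMass p ends o a₁ a₂ b 9 * cellMass p ends o a₁ a₂ b 8 := by
  have h := HB1_holds p hp ends o a₂ a₁ b
  unfold HB1 at h
  rwa [cellMass_swap_roots_one, cellMass_swap_roots_four, cellMass_swap_roots_nine,
    cellMass_swap_roots_ten] at h

/-- **Sibling `c₆ · c₁₀ ≤ c₉ · c₈`** (both relabellings). -/
theorem HB1_both (p : E → R) (hp : IsProbVec p) (ends : E → Sym2 V) (o a₁ a₂ b : V) :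
    cellMass p ends o a₁ a₂ b 6 * cellMass p ends o a₁ a₂ b 10 ≤
      cellMass p ends o a₁ a₂ b 9 * cellMass p ends o a₁ a₂ b 8 := by
  have h := HB1_ob p hp ends o a₂ a₁ b
  rwa [cellMass_swap_roots_three, cellMass_swap_roots_four, cellMass_swap_roots_nine,
    cellMass_swap_roots_ten] at h

omit [Fintype E] [DecidableEq E] in
/-- Cell `1` is `L1 {a₂}` with the source `a₁` and the marks `a := b`, `o := o`. -/
lemma cell_one_eq_L1_root (ends : E → Sym2 V) (o a₁ a₂ b : V) :
    {ω : Config E | cellIdx ends ω o a₁ a₂ b = 1} = TwoMark.L1 ends Finset.univ a₁ b o {a₂} := by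
  ext ω
  simp only [Set.mem_setOf_eq, TwoMark.L1, Set.mem_inter_iff, mem_QEvent, mem_REvent,
    Finset.forall_mem_union, Finset.mem_singleton, forall_eq, TwoMark.conn_induced_univ]
  constructor
  · intro h
    obtain ⟨hQ, hb, ho1, ho2⟩ := of_cellIdx_eq_one h
    exact ⟨⟨hb, ho1, hQ⟩, fun h' => ho2 (conn_symm h')⟩
  · rintro ⟨⟨hb, ho1, hQ⟩, ho2⟩
    exact cellIdx_eq_one hQ hb ho1 (fun h' => ho2 (conn_symm h'))

omit [Fintype E] [DecidableEq E] in
/-- Cell `3` is `L2 {a₂}` with the source `a₁` and the marks `a := b`, `o := o`. -/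
lemma cell_three_eq_L2_root (ends : E → Sym2 V) (o a₁ a₂ b : V) :
    {ω : Config E | cellIdx ends ω o a₁ a₂ b = 3} = TwoMark.L2 ends Finset.univ a₁ b o {a₂} := by
  ext ω
  simp only [Set.mem_setOf_eq, TwoMark.L2, Set.mem_inter_iff, mem_QEvent, mem_REvent,
    Finset.forall_mem_union, Finset.mem_singleton, forall_eq, TwoMark.conn_induced_univ]
  constructor
  · intro h
    obtain ⟨hQ, ho, hb1, hb2⟩ := of_cellIdx_eq_three h
    exact ⟨⟨ho, hb1, hQ⟩, fun h' => hb2 (conn_symm h')⟩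
  · rintro ⟨⟨ho, hb1, hQ⟩, hb2⟩
    exact cellIdx_eq_three hQ ho hb1 (fun h' => hb2 (conn_symm h'))

omit [Fintype E] [DecidableEq E] in
/-- Cell `4` is `R1 {a₂}` with the source `a₁`. -/
lemma cell_four_eq_R1_root (ends : E → Sym2 V) (o a₁ a₂ b : V) :
    {ω : Config E | cellIdx ends ω o a₁ a₂ b = 4} = TwoMark.R1 ends Finset.univ a₁ b o {a₂} := by
  ext ω
  simp only [Set.mem_setOf_eq, TwoMark.R1, Set.mem_inter_iff, mem_QEvent, mem_REvent,
    Finset.forall_mem_insert, Finset.mem_singleton, forall_eq, TwoMark.conn_induced_univ]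
  constructor
  · intro h
    obtain ⟨hQ, ho, hb⟩ := of_cellIdx_eq_four h
    exact ⟨⟨hb, ho⟩, hQ⟩
  · rintro ⟨⟨hb, ho⟩, hQ⟩
    exact cellIdx_eq_four hQ ho hb

omit [Fintype E] [DecidableEq E] in
/-- Cell `9` is `R2 {a₂}` with the source `a₁`. -/
lemma cell_nine_eq_R2_root (ends : E → Sym2 V) (o a₁ a₂ b : V) :
    {ω : Config E | cellIdx ends ω o a₁ a₂ b = 9} = TwoMark.R2 ends Finset.univ a₁ b o {a₂} := by
  ext ω
  simp only [Set.mem_setOf_eq, TwoMark.R2, Set.mem_inter_iff, mem_REvent,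
    Finset.forall_mem_union, Finset.forall_mem_insert, Finset.mem_singleton, forall_eq,
    TwoMark.conn_induced_univ]
  constructor
  · intro h
    obtain ⟨hQ, ⟨ho1, ho2⟩, ⟨hb1, hb2⟩, hob⟩ := of_cellIdx_eq_nine h
    exact ⟨⟨⟨⟨hb1, ho1⟩, hQ⟩, fun h' => hob (conn_symm h'), fun h' => hb2 (conn_symm h')⟩,
      fun h' => ho2 (conn_symm h')⟩
  · rintro ⟨⟨⟨⟨hb1, ho1⟩, hQ⟩, hbo, hba2⟩, hoa2⟩
    exact cellIdx_eq_nine hQ ho1 (fun h' => hoa2 (conn_symm h')) hb1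
      (fun h' => hba2 (conn_symm h')) (fun h' => hbo (conn_symm h'))

/-- **`c₁ · c₃ ≤ c₉ · c₄`**: the two-mark avoidance inequality with the source `a₁` (marks `b`, `o`,
`X = Y = {a₂}`). -/
theorem HB1_root_source (p : E → R) (hp : IsProbVec p) (ends : E → Sym2 V) (o a₁ a₂ b : V) :
    cellMass p ends o a₁ a₂ b 1 * cellMass p ends o a₁ a₂ b 3 ≤
      cellMass p ends o a₁ a₂ b 9 * cellMass p ends o a₁ a₂ b 4 := by
  unfold cellMass
  rw [cell_one_eq_L1_root, cell_three_eq_L2_root, cell_four_eq_R1_root, cell_nine_eq_R2_root]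
  have h := TwoMark.twoMark p hp ends a₁ b o {a₂} {a₂}
  rw [Finset.inter_self, Finset.union_self] at h
  rw [mul_comm (prob p (TwoMark.R2 ends Finset.univ a₁ b o {a₂}))]
  exact h

end Siblings

end CaseOne

end Summit.Ventures.PercRepro2
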